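import Literature.MathematicalPhysics.QuantumFieldTheory.VillainGasTrigSplit
import Literature.MathematicalPhysics.QuantumFieldTheory.VillainCoulombGas
import HarnessLib

/-!
# The flux gas of the Villain cube is even: `g(−ξ) = g(ξ)`, `φ(−ξ) = −φ(ξ)`, odd gas observables average to zero

Companion of `VillainSheetDuality` / `VillainGasTrigSplit`.  In Fröhlich–Spencer's dual model (FS82 §2.4 (2.24)) the flux classes `ξ`
form the abelian group `ℤ^{P_n}/dℤ^{E¹_n}`; the Coulomb weight `g(ξ) = Z e^{−(β/2)‖(2πξ.out)_⊥‖²}` and the disorder phases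
`φ_a(ξ) = ⟨(2πξ.out)_⊥, a⟩` do not depend on the representative (the orthogonal part kills integer coboundaries), so the gas is symmetric
under `ξ ↦ −ξ`:

* `perpPart_dMat_mulVec`, `perpPart_intCast_dFree`: `(Tv)_⊥ = 0`, in particular for integer coboundaries;
* `perpPart_fluxRep_neg`: `(2π(−ξ).out)_⊥ = −(2πξ.out)_⊥`; `coulombWeight_neg`: `g(−ξ) = g(ξ)`;
* **`tsum_coulombWeight_mul_eq_zero_of_odd`**: `∑_ξ g(ξ) F((2πξ.out)_⊥) = 0` for every bounded ODD `F` (`F(−v) = −F(v)`, `|F| ≤ 1`);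
* corollaries `gasSin_eq_zero` (`⟨sin φ_a⟩_g = 0`) and `gasSinCos_eq_zero` (`⟨sin φ_a cos φ_b⟩_g = 0`) — so the monopole term
  `⟨sin φ_p sin φ_q⟩_g` of `VillainGasTrigSplit` is a genuine covariance, and `A(a) = ⟨cos φ_a⟩_g` with no sine part.

Exact finite-volume statements; no estimate.  Everything is proved; no named fact is introduced.

## References

* J. Fröhlich, T. Spencer, Comm. Math. Phys. 83 (1982) 411–454, §2.4 (2.24) (the dual flux ensemble), §2.11 (2.90).
  [FrohlichSpencerCMP1982]
-/

noncomputable section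

open Finset Function Matrix
open scoped Real
open Literature.Probability.LatticeModels
open Literature.Probability.LatticeModels.GaussianCoord (exactPart perpPart exactEnergy)

namespace Literature.MathematicalPhysics.QuantumFieldTheory

namespace VillainAngle

open AxialGauge LatticeForm VillainFibre

variable {d n : ℕ} {β : ℝ}

/-! ### The orthogonal part kills exact fields -/

/-- `(Tv)_⊥ = 0`: the orthogonal part of an exact real plaquette field vanishes. [cite: FrohlichSpencerCMP1982, §2.7 (2.50)–(2.51)] -/
theorem perpPart_dMat_mulVec (v : FIdx d n → ℝ) : perpPart dMat (dMat (d := d) (n := n) *ᵥ v) = 0 := by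
  have hdet : IsUnit (Literature.Probability.LatticeModels.GaussianCoord.gram (dMat (d := d) (n := n))).det :=
    (Matrix.isUnit_iff_isUnit_det _).1 posDef_gram_dMat.isUnit
  have h1 : (dMat (d := d) (n := n))ᵀ *ᵥ (dMat (d := d) (n := n) *ᵥ v) =
      Literature.Probability.LatticeModels.GaussianCoord.gram (dMat (d := d) (n := n)) *ᵥ v := by
    rw [Matrix.mulVec_mulVec]; rfl
  have h2 : (Literature.Probability.LatticeModels.GaussianCoord.gram (dMat (d := d) (n := n)))⁻¹ *ᵥ
      (Literature.Probability.LatticeModels.GaussianCoord.gram (dMat (d := d) (n := n)) *ᵥ v) = v := by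
    rw [Matrix.mulVec_mulVec, Matrix.nonsing_inv_mul _ hdet, Matrix.one_mulVec]
  rw [perpPart, exactPart, h1, h2, sub_self]

/-- The orthogonal part of (the real cast of) an integer coboundary vanishes. [cite: FrohlichSpencerCMP1982, §2.7 (2.50)–(2.51)] -/
theorem perpPart_intCast_dFree (ℓ : FreeInt d n) : perpPart dMat (fun p => (dFree ℓ p : ℝ)) = 0 := by
  rw [← dFreeR_intCast, ← dMat_mulVec, perpPart_dMat_mulVec]

/-! ### The involution `ξ ↦ −ξ` -/

/-- **The disorder field is odd in the flux class**: `(2π(−ξ).out)_⊥ = −(2πξ.out)_⊥` (the two representatives `(−ξ).out` and `−ξ.out`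
differ by an integer coboundary). [cite: FrohlichSpencerCMP1982, §2.4 (2.24)] -/
theorem perpPart_fluxRep_neg (ξ : (PIdx d n → ℤ) ⧸ (dFree (d := d) (n := n)).range) :
    perpPart dMat (fluxRep (-ξ)) = -perpPart dMat (fluxRep ξ) := by
  -- the two representatives of `-ξ`
  have hmk : (QuotientAddGroup.mk ((-ξ).out) : (PIdx d n → ℤ) ⧸ (dFree (d := d) (n := n)).range) =
      QuotientAddGroup.mk (-ξ.out) := by
    rw [QuotientAddGroup.out_eq', QuotientAddGroup.mk_neg, QuotientAddGroup.out_eq']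
  obtain ⟨ℓ, hℓ⟩ := QuotientAddGroup.eq.1 hmk.symm
  -- `(-ξ).out = -ξ.out + dℓ`
  have hrep : ((-ξ).out : PIdx d n → ℤ) = -ξ.out + dFree ℓ := by
    rw [hℓ]; abel
  have hcast : (fun p => (((-ξ).out : PIdx d n → ℤ) p : ℝ)) =
      -(fun p => ((ξ.out : PIdx d n → ℤ) p : ℝ)) + fun p => (dFree ℓ p : ℝ) := by
    funext p
    rw [hrep]
    simp only [Pi.add_apply, Pi.neg_apply, Int.cast_add, Int.cast_neg]
  rw [fluxRep, fluxRep, hcast, smul_add, smul_neg, perpPart_add,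
    perpPart_smul _ _ (fun p => (dFree ℓ p : ℝ)), perpPart_intCast_dFree, smul_zero, add_zero,
    show (-((2 * Real.pi) • fun p => ((ξ.out : PIdx d n → ℤ) p : ℝ))) =
      (-1 : ℝ) • ((2 * Real.pi) • fun p => ((ξ.out : PIdx d n → ℤ) p : ℝ)) by rw [neg_one_smul],
    perpPart_smul, neg_one_smul]

/-- **The Coulomb weights are even**: `g(−ξ) = g(ξ)`. [cite: FrohlichSpencerCMP1982, §2.4 (2.24)] -/
theorem coulombWeight_neg (β : ℝ) (ξ : (PIdx d n → ℤ) ⧸ (dFree (d := d) (n := n)).range) :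
    coulombWeight β (-ξ) = coulombWeight β ξ := by
  rw [coulombWeight, coulombWeight, perpPart_fluxRep_neg, neg_dotProduct, dotProduct_neg, neg_neg]

/-- **Odd gas observables average to zero**: for `F` odd (`F(−v) = −F(v)`) and bounded (`|F| ≤ 1`),
`∑_ξ g(ξ) F((2πξ.out)_⊥) = 0` (reindex the absolutely convergent series by `ξ ↦ −ξ`). [cite: FrohlichSpencerCMP1982, §2.4 (2.24)] -/
theorem tsum_coulombWeight_mul_eq_zero_of_odd (β : ℝ) {F : (PIdx d n → ℝ) → ℝ} (hodd : ∀ v, F (-v) = -F v) :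
    ∑' ξ : (PIdx d n → ℤ) ⧸ (dFree (d := d) (n := n)).range, coulombWeight β ξ * F (perpPart dMat (fluxRep ξ)) = 0 := by
  set G : (PIdx d n → ℤ) ⧸ (dFree (d := d) (n := n)).range → ℝ := fun ξ => coulombWeight β ξ * F (perpPart dMat (fluxRep ξ)) with hG
  have hneg : ∀ ξ, G (-ξ) = -G ξ := fun ξ => by
    simp only [hG, coulombWeight_neg, perpPart_fluxRep_neg, hodd, mul_neg]
  have h1 : ∑' ξ, G ξ = ∑' ξ, G (-ξ) := ((Equiv.neg _).tsum_eq G).symm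
  have h2 : ∑' ξ, G (-ξ) = -∑' ξ, G ξ := by
    rw [← tsum_neg]; exact tsum_congr fun ξ => hneg ξ
  show ∑' ξ, G ξ = 0
  linarith [h1.trans h2]

/-- `⟨sin φ_a⟩_g = 0`: the sine of a disorder phase has vanishing gas average. [cite: FrohlichSpencerCMP1982, §2.11 (2.90)] -/
theorem gasSin_eq_zero (β : ℝ) (a : PIdx d n → ℝ) :
    ∑' ξ : (PIdx d n → ℤ) ⧸ (dFree (d := d) (n := n)).range,
        coulombWeight β ξ * Real.sin (perpPart dMat (fluxRep ξ) ⬝ᵥ a) = 0 :=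
  tsum_coulombWeight_mul_eq_zero_of_odd β (F := fun v => Real.sin (v ⬝ᵥ a)) fun v => by
    rw [neg_dotProduct, Real.sin_neg]

/-- `⟨sin φ_a cos φ_b⟩_g = 0`. [cite: FrohlichSpencerCMP1982, §2.11 (2.90)] -/
theorem gasSinCos_eq_zero (β : ℝ) (a b : PIdx d n → ℝ) :
    ∑' ξ : (PIdx d n → ℤ) ⧸ (dFree (d := d) (n := n)).range,
        coulombWeight β ξ * (Real.sin (perpPart dMat (fluxRep ξ) ⬝ᵥ a) * Real.cos (perpPart dMat (fluxRep ξ) ⬝ᵥ b)) = 0 :=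
  tsum_coulombWeight_mul_eq_zero_of_odd β (F := fun v => Real.sin (v ⬝ᵥ a) * Real.cos (v ⬝ᵥ b)) fun v => by
    rw [neg_dotProduct, neg_dotProduct, Real.sin_neg, Real.cos_neg, neg_mul]

/-- **The flux-gas average of a sheet is the average of the cosine alone, and is even in the sheet**: `A(−a) = A(a)`.
[cite: FrohlichSpencerCMP1982, §2.4 (2.24)] -/
theorem tsum_coulombWeight_cos_neg (β : ℝ) (a : PIdx d n → ℝ) :
    ∑' ξ : (PIdx d n → ℤ) ⧸ (dFree (d := d) (n := n)).range,
        coulombWeight β ξ * Real.cos (perpPart dMat (fluxRep ξ) ⬝ᵥ (-a)) =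
      ∑' ξ : (PIdx d n → ℤ) ⧸ (dFree (d := d) (n := n)).range,
        coulombWeight β ξ * Real.cos (perpPart dMat (fluxRep ξ) ⬝ᵥ a) :=
  tsum_congr fun ξ => by rw [dotProduct_neg, Real.cos_neg]

end VillainAngle

end Literature.MathematicalPhysics.QuantumFieldTheory
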